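import Summits.QuantumAdvantage.QuantumAdvantage.Theorems.WbwObfuscatedGluedTreesKowObfuscationMonotoneMachine
import Summits.QuantumAdvantage.QuantumAdvantage.Theorems.WbwObfuscatedGluedTreesKowVocabulary

/-!
# `WbwObfuscatedGluedTrees` (stmt-QuantumAdvantage-2340) — line `knowledge-of-walk-split`, stub `stub_obfuscationMonotone` II: the stub

The registered stub `stub_obfuscationMonotone` of the skeleton
`Cruxes/WbwObfuscatedGluedTrees/Lines/knowledge-of-walk-split.lean` (crux `WbwObfuscatedGluedTrees`, route
`WhiteBoxWalk`; lead prover-line-stmt-QuantumAdvantage-2340-0), EXACT registered signature: for an efficient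
obfuscator `O`, a unary-poly-time schedule `κ ≤ poly`, key length `h n ≤ n`, polynomially long clear instances
and the eventual (`|s| ≥ n₀`) coin discipline `O.coins (κ n) (C k) ≤ n − h n`,
`ClauseC (genClear h m C nm) (keyed h ans) → ClauseC (genObf O κ h m C nm) (keyed h ans)`
(vocabulary of `WbwObfuscatedGluedTreesKowVocabulary`, `ClauseC` of `Negative/LoadBearing`).

Proof (a plain simulation; no security property of `O`): fix a PPT `A` against the obfuscated instances, let
`A₁ = CoinNormalisation.norm A pA` (coin-count normalisation: prefix-stable, PPT, `A ≤ 2^{width} · A₁`) and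
`A' = ObfMono.redAlg K Ob A₁ qO QP` (file I; `K`, `Ob` = total `FP` extensions of the machines of `κ` and `O`,
`FPExtension.exists_FP_unary/obf`).  On the genuine clear input `x0 n k = ⟨1ⁿ, ⟨code (C k), nm k⟩⟩` the
reduction recomputes EXACTLY `O`'s input `⟨1^{κ n}, code (C k)⟩` (`ObfMono.inO_x0`), so its manufactured input
with coins `r` is the obfuscated instance `x1 n k r` (`ObfMono.newInput_x0`) and the budget `QP |x0|` suffices
(`ObfMono.budget_le`).  `ObfMono.domination`: by `A ≤ ℓA · A₁`, the seed law
(`SeedLaw.uniformAvg_eq_key_coins`: the obfuscator's coins are a uniform prefix of the uniform seed tail), the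
guessing inequality `ObfMono.pr_redAlg_ge` per key and `2^{w} ≤ ℓO`,
`succ_A(genObf, n) ≤ lossP(n) · succ_{A'}(genClear, n)` for `n ≥ n₀`; the right-hand side decays
superpolynomially by the hypothesis applied to the PPT `A'` (`SuperpolynomialDecay.polynomial_mul`,
`trans_eventually_abs_le` along `eventually_ge_atTop n₀`).
-/

set_option linter.dupNamespace false

noncomputable section

namespace Summit.QuantumAdvantage.QuantumAdvantage.Theorems.WbwObfuscatedGluedTrees.KnowledgeOfWalk

open Literature.Computability.Cryptography Literature.Computability.Complexity Filter Asymptotics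
open _root_.Computability Brick Plumb
open Summit.QuantumAdvantage.QuantumAdvantage.Theorems.WbwObfuscatedGluedTrees.Negative (ClauseC)

namespace ObfMono

/-! ### Genuine inputs: the clear instance `x0` and the obfuscated instance `x1` -/

/-- The clear input `⟨1ⁿ, ⟨code (C k), nm k⟩⟩` at level `n` with key `k`. [folklore] -/
def x0 (m : List Bool → ℕ) (C : (k : List Bool) → Circuit (Fin (m k))) (nm : List Bool → List Bool)
    (n : ℕ) (k : List Bool) : List Bool :=
  boolPair (unaryEncodeNat n) (boolPair (encodeSizedCircuit ⟨m k, C k⟩) (nm k))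

/-- The obfuscated input `⟨1ⁿ, ⟨code (O(κ n, C k; r)), nm k⟩⟩` with obfuscator coins `r`. [folklore] -/
def x1 (O : CircuitObfuscator) (κ : ℕ → ℕ) (m : List Bool → ℕ) (C : (k : List Bool) → Circuit (Fin (m k)))
    (nm : List Bool → List Bool) (n : ℕ) (k r : List Bool) : List Bool :=
  boolPair (unaryEncodeNat n) (boolPair (encodeSizedCircuit ⟨m k, O.obf (κ n) (C k) r⟩) (nm k))

/-- The clause-(C) input for `genClear` at a seed of length `n` is `x0` at its key. [folklore] -/
theorem x0_eq (h : ℕ → ℕ) (m : List Bool → ℕ) (C : (k : List Bool) → Circuit (Fin (m k)))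
    (nm : List Bool → List Bool) {n : ℕ} {s : List Bool} (hs : s.length = n) :
    boolPair (unaryEncodeNat n) (genClear h m C nm s) = x0 m C nm n (s.take (h n)) := by
  subst hs; rfl

/-- The clause-(C) input for `genObf` at a seed of length `n` is `x1` at its key and the coin prefix of the
seed tail. [folklore] -/
theorem x1_eq (O : CircuitObfuscator) (κ h : ℕ → ℕ) (m : List Bool → ℕ)
    (C : (k : List Bool) → Circuit (Fin (m k))) (nm : List Bool → List Bool) {n : ℕ} {s : List Bool}
    (hs : s.length = n) :
    boolPair (unaryEncodeNat n) (genObf O κ h m C nm s) =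
      x1 O κ m C nm n (s.take (h n)) ((s.drop (h n)).take (O.coins (κ n) (C (s.take (h n))))) := by
  subst hs; rfl

/-- The keyed answer at a seed of length `n`. [folklore] -/
theorem keyed_eq (h : ℕ → ℕ) (ans : List Bool → List Bool) {n : ℕ} {s : List Bool} (hs : s.length = n) :
    keyed h ans s = ans (s.take (h n)) := by
  subst hs; rfl

/-- The (eventual) coin discipline at a seed of length `n ≥ n₀`. [folklore] -/
theorem coins_seed_le {O : CircuitObfuscator} {κ h : ℕ → ℕ} {m : List Bool → ℕ}
    {C : (k : List Bool) → Circuit (Fin (m k))} {n₀ : ℕ}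
    (hcoins : ∀ s : List Bool, n₀ ≤ s.length →
      O.coins (κ s.length) (C (s.take (h s.length))) ≤ s.length - h s.length)
    {n : ℕ} (hn : n₀ ≤ n) {s : List Bool} (hs : s.length = n) :
    O.coins (κ n) (C (s.take (h n))) ≤ n - h n := by
  subst hs; exact hcoins s hn

/-- The length of the clear input at a seed of length `n` is at most `2n + 2 + q n`. [folklore] -/
theorem length_x0_seed_le {h : ℕ → ℕ} {m : List Bool → ℕ} {C : (k : List Bool) → Circuit (Fin (m k))}
    {nm : List Bool → List Bool} {q : Polynomial ℕ}
    (hq : ∀ s : List Bool, (genClear h m C nm s).length ≤ q.eval s.length)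
    {n : ℕ} {s : List Bool} (hs : s.length = n) :
    (x0 m C nm n (s.take (h n))).length ≤ 2 * n + 2 + q.eval n := by
  rw [← x0_eq h m C nm hs, length_boolPair, FPExtension.unaryEncodeNat_eq_ones, List.length_replicate]
  have := hq s
  rw [hs] at this
  omega

/-- Every key of length `h n ≤ n` is the key of some seed of length `n`. [folklore] -/
theorem exists_seed {h : ℕ → ℕ} {n : ℕ} (hh : h n ≤ n) {k : List Bool} (hk : k.length = h n) :
    ∃ s : List Bool, s.length = n ∧ s.take (h n) = k := by
  refine ⟨k ++ List.replicate (n - h n) false, ?_, ?_⟩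
  · simp only [List.length_append, List.length_replicate, hk]
    omega
  · rw [← hk]
    exact List.take_left

section genuine

variable {O : CircuitObfuscator} {κ : ℕ → ℕ} {K Ob : List Bool → List Bool}
  (hK : ∀ n, K (unaryEncodeNat n) = unaryEncodeNat (κ n))
  (hOb : ∀ (κ' n' : ℕ) (C' : Circuit (Fin n')) (r : List Bool),
    Ob (boolPair (boolPair (unaryEncodeNat κ') (encodeSizedCircuit ⟨n', C'⟩)) r) =
      encodeSizedCircuit ⟨n', O.obf κ' C' r⟩)
  (m : List Bool → ℕ) (C : (k : List Bool) → Circuit (Fin (m k))) (nm : List Bool → List Bool) (n : ℕ)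
  (k : List Bool)

include hK in
/-- On the clear input the reduction recomputes EXACTLY the obfuscator's input `⟨1^{κ n}, code (C k)⟩`.
[folklore] -/
theorem inO_x0 : inO K (x0 m C nm n k) = CircuitObfuscator.encodeInput (κ n, ⟨m k, C k⟩) := by
  simp [inO, x0, hK, CircuitObfuscator.encodeInput]

include hK in
/-- Hence `O`'s true coin count on `(κ n, C k)` is `O.coinLen |inO|`. [folklore] -/
theorem coins_eq : O.coins (κ n) (C k) = O.coinLen (inO K (x0 m C nm n k)).length := by
  rw [inO_x0 hK]; rfl

include hK hOb in
/-- On the clear input, the manufactured input with coins `r` is the obfuscated input `x1 … r`.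
[folklore] -/
theorem newInput_x0 (r : List Bool) : newInput K Ob (x0 m C nm n k) r = x1 O κ m C nm n k r := by
  simp [newInput, inO, x0, x1, hK, hOb]

include hK in
/-- `|inO| ≤ L0P |x0|`. [folklore] -/
theorem length_inO_x0_le {pκ : Polynomial ℕ} (hpκ : ∀ n, κ n ≤ pκ.eval n) :
    (inO K (x0 m C nm n k)).length ≤ (L0P pκ).eval (x0 m C nm n k).length := by
  rw [inO_x0 hK, eval_L0P]
  have hn : n ≤ (x0 m C nm n k).length := by
    simp only [x0, length_boolPair, FPExtension.unaryEncodeNat_eq_ones, List.length_replicate]; omega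
  have h1 := hpκ n
  have h2 := SeedLaw.natPoly_eval_mono pκ hn
  have h3 : (encodeSizedCircuit ⟨m k, C k⟩).length ≤ (x0 m C nm n k).length := by
    simp only [x0, length_boolPair, FPExtension.unaryEncodeNat_eq_ones, List.length_replicate]; omega
  simp only [CircuitObfuscator.encodeInput, length_boolPair, FPExtension.unaryEncodeNat_eq_ones,
    List.length_replicate]
  omega

include hK hOb in
/-- `|x1 … r| ≤ XP |x0|` for `|r| ≤ qO |inO|`. [folklore] -/
theorem length_x1_le {pκ qO sOb : Polynomial ℕ} (hsOb : ∀ y, (Ob y).length ≤ sOb.eval y.length)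
    (hpκ : ∀ n, κ n ≤ pκ.eval n) {r : List Bool} (hr : r.length ≤ qO.eval (inO K (x0 m C nm n k)).length) :
    (x1 O κ m C nm n k r).length ≤ (XP pκ qO sOb).eval (x0 m C nm n k).length := by
  have h0 := length_inO_x0_le hK m C nm n k hpκ
  have hc' : (encodeSizedCircuit ⟨m k, O.obf (κ n) (C k) r⟩).length ≤
      sOb.eval ((L1P pκ qO).eval (x0 m C nm n k).length) := by
    rw [← hOb (κ n) (m k) (C k) r]
    refine (hsOb _).trans (SeedLaw.natPoly_eval_mono sOb ?_)
    rw [eval_L1P]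
    have h1 := SeedLaw.natPoly_eval_mono qO h0
    have h2 : (boolPair (unaryEncodeNat (κ n)) (encodeSizedCircuit ⟨m k, C k⟩)).length =
        (inO K (x0 m C nm n k)).length := by
      rw [inO_x0 hK]; rfl
    simp only [length_boolPair] at h2 ⊢
    omega
  rw [eval_XP]
  have he : (nm k).length + 2 * n + 2 ≤ (x0 m C nm n k).length := by
    simp only [x0, length_boolPair, FPExtension.unaryEncodeNat_eq_ones, List.length_replicate]; omega
  simp only [x1, length_boolPair, FPExtension.unaryEncodeNat_eq_ones, List.length_replicate]
  omega

include hK hOb in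
/-- **The budget suffices**: guess block + obfuscator coins + the adversary's demand on every manufactured
input fit in `QP |x0|` coins. [folklore] -/
theorem budget_le {pκ qO sOb pA : Polynomial ℕ} (hsOb : ∀ y, (Ob y).length ≤ sOb.eval y.length)
    (hpκ : ∀ n, κ n ≤ pκ.eval n) {A₁ : RandAlg (List Bool) (List Bool)}
    (hA₁c : ∀ L, A₁.coinLen L ≤ 2 * pA.eval L + 1) {r : List Bool}
    (hr : r.length ≤ qO.eval (inO K (x0 m C nm n k)).length) :
    CoinNormalisation.width qO (inO K (x0 m C nm n k)).length + qO.eval (inO K (x0 m C nm n k)).length +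
        A₁.coinLen (newInput K Ob (x0 m C nm n k) r).length ≤
      (QP pκ qO sOb pA).eval (x0 m C nm n k).length := by
  rw [newInput_x0 hK hOb, eval_QP]
  have h0 := length_inO_x0_le hK m C nm n k hpκ
  have h1 := length_x1_le hK hOb m C nm n k hsOb hpκ hr
  have hw := CoinNormalisation.width_le qO (inO K (x0 m C nm n k)).length
  have hq := SeedLaw.natPoly_eval_mono qO h0
  have hc := hA₁c (x1 O κ m C nm n k r).length
  have hp := SeedLaw.natPoly_eval_mono pA h1
  omega

end genuine

/-! ### Per-level domination `succ_A(genObf) ≤ loss(n) · succ_{A'}(genClear)` -/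

/-- **Domination at level `n`.**  For an adversary `A` with coin bound `pA`, a prefix-stable `A₁` dominating
it at loss `2^{width pA |x|}` with demand `≤ 2 pA + 1` (e.g. its coin-count normalisation), total extensions
`K` of the schedule and `Ob` of the obfuscator (output length `≤ sOb`), and `O.coinLen ≤ qO`: the success of
`A` against the obfuscated instances is at most `lossP(n)` times the success of the reduction against the
clear instances, at every level `n` with `h n ≤ n` where the coin discipline `O.coins (κ n) (C k) ≤ n − h n`
holds (seed law: the obfuscator's coins are a uniform prefix of the uniform seed tail; coin-count guessing for
`O` and for `A`). [cite: AroraBarakCC2009, §7.1] -/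
theorem domination {O : CircuitObfuscator} {κ h : ℕ → ℕ} {m : List Bool → ℕ}
    {C : (k : List Bool) → Circuit (Fin (m k))} {nm ans : List Bool → List Bool}
    {K Ob : List Bool → List Bool} {A A₁ : RandAlg (List Bool) (List Bool)} {pA qO pκ sOb q : Polynomial ℕ}
    (hK : ∀ n, K (unaryEncodeNat n) = unaryEncodeNat (κ n))
    (hOb : ∀ (κ' n' : ℕ) (C' : Circuit (Fin n')) (r : List Bool),
      Ob (boolPair (boolPair (unaryEncodeNat κ') (encodeSizedCircuit ⟨n', C'⟩)) r) =
        encodeSizedCircuit ⟨n', O.obf κ' C' r⟩)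
    (hsOb : ∀ y, (Ob y).length ≤ sOb.eval y.length) (hpκ : ∀ n, κ n ≤ pκ.eval n)
    (hqO : ∀ L, O.coinLen L ≤ qO.eval L)
    (hstab : ∀ (x : List Bool) (E : Set (List Bool)) (N : ℕ), A₁.coinLen x.length ≤ N →
      uniformProb N {ρ | A₁.run x ρ ∈ E} = A₁.pr id x E)
    (hdomA : ∀ (x : List Bool) (E : Set (List Bool)),
      A.pr id x E ≤ (2 : ℝ) ^ CoinNormalisation.width pA x.length * A₁.pr id x E)
    (hA₁c : ∀ L, A₁.coinLen L ≤ 2 * pA.eval L + 1)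
    (hq : ∀ s : List Bool, (genClear h m C nm s).length ≤ q.eval s.length) {n : ℕ} (hh : h n ≤ n)
    (hcoins : ∀ s : List Bool, s.length = n → O.coins (κ n) (C (s.take (h n))) ≤ n - h n) :
    uniformAvg n (fun s => A.pr id (boolPair (unaryEncodeNat n) (genObf O κ h m C nm s))
        {y | keyed h ans s <+: y}) ≤
      (((lossP pκ qO sOb pA q).eval n : ℕ) : ℝ) *
        uniformAvg n (fun s => (redAlg K Ob A₁ qO (QP pκ qO sOb pA)).pr id
          (boolPair (unaryEncodeNat n) (genClear h m C nm s)) {y | keyed h ans s <+: y}) := by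
  obtain ⟨Lmax, hLmax⟩ : ∃ L : ℕ, L = 2 * n + 2 + q.eval n := ⟨_, rfl⟩
  obtain ⟨ℓA, hℓA⟩ : ∃ t : ℝ, t = 2 * ((pA.eval ((XP pκ qO sOb).eval Lmax) : ℕ) : ℝ) + 2 := ⟨_, rfl⟩
  obtain ⟨ℓO, hℓO⟩ : ∃ t : ℝ, t = 2 * ((qO.eval ((L0P pκ).eval Lmax) : ℕ) : ℝ) + 2 := ⟨_, rfl⟩
  -- keys of length `h n`: the clear input is short and the coin discipline holds
  have hkey : ∀ k : List Bool, k.length = h n →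
      (x0 m C nm n k).length ≤ Lmax ∧ O.coins (κ n) (C k) ≤ n - h n := by
    intro k hk
    obtain ⟨s, hs, hsk⟩ := exists_seed hh hk
    subst hsk
    exact ⟨hLmax ▸ length_x0_seed_le hq hs, hcoins s hs⟩
  -- Step 1: `A ≤ ℓA · A₁` on every obfuscated instance
  have hstep1 : ∀ s : List Bool, s.length = n →
      A.pr id (boolPair (unaryEncodeNat n) (genObf O κ h m C nm s)) {y | keyed h ans s <+: y} ≤
        ℓA * A₁.pr id (boolPair (unaryEncodeNat n) (genObf O κ h m C nm s)) {y | keyed h ans s <+: y} := by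
    intro s hs
    have hlen : (boolPair (unaryEncodeNat n) (genObf O κ h m C nm s)).length ≤ (XP pκ qO sOb).eval Lmax := by
      rw [x1_eq O κ h m C nm hs]
      refine (length_x1_le hK hOb m C nm n _ hsOb hpκ ?_).trans (SeedLaw.natPoly_eval_mono _ ?_)
      · rw [List.length_take, coins_eq hK m C nm n]
        exact (min_le_left _ _).trans (hqO _)
      · exact hLmax ▸ length_x0_seed_le hq hs
    refine (hdomA _ _).trans (mul_le_mul_of_nonneg_right ?_ (RandAlg.pr_nonneg _ _ _ _))
    refine (CoinNormalisation.two_pow_width_le pA _).trans ?_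
    have := SeedLaw.natPoly_eval_mono pA hlen
    rw [hℓA]
    exact_mod_cast (by omega : 2 * pA.eval (boolPair (unaryEncodeNat n) (genObf O κ h m C nm s)).length + 2 ≤
      2 * pA.eval ((XP pκ qO sOb).eval Lmax) + 2)
  -- Step 2: the seed law
  have hstep2 : uniformAvg n (fun s => A₁.pr id (boolPair (unaryEncodeNat n) (genObf O κ h m C nm s))
      {y | keyed h ans s <+: y}) =
      uniformAvg (h n) (fun k => uniformAvg (O.coins (κ n) (C k))
        (fun r => A₁.pr id (x1 O κ m C nm n k r) {y | ans k <+: y})) := by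
    refine SeedLaw.uniformAvg_eq_key_coins hh (fun k => O.coins (κ n) (C k)) (fun k hk => (hkey k hk).2) _
      (fun k r => A₁.pr id (x1 O κ m C nm n k r) {y | ans k <+: y}) ?_
    intro s hs
    rw [x1_eq O κ h m C nm hs, keyed_eq h ans hs]
  -- Step 3: per key, the guessing inequality of the reduction
  have hstep3 : ∀ k : List Bool, k.length = h n →
      uniformAvg (O.coins (κ n) (C k)) (fun r => A₁.pr id (x1 O κ m C nm n k r) {y | ans k <+: y}) ≤
        ℓO * (redAlg K Ob A₁ qO (QP pκ qO sOb pA)).pr id (x0 m C nm n k) {y | ans k <+: y} := by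
    intro k hk
    have hj : O.coins (κ n) (C k) ≤ qO.eval (inO K (x0 m C nm n k)).length := by
      rw [coins_eq hK m C nm n k]; exact hqO _
    have hge := pr_redAlg_ge K Ob A₁ qO (QP pκ qO sOb pA) hstab (x0 m C nm n k) {y | ans k <+: y} hj
      (fun r hr => budget_le hK hOb m C nm n k hsOb hpκ hA₁c hr)
    simp only [newInput_x0 hK hOb] at hge
    have hpos : (0 : ℝ) < 2 ^ CoinNormalisation.width qO (inO K (x0 m C nm n k)).length := by positivity
    have h2w : (2 : ℝ) ^ CoinNormalisation.width qO (inO K (x0 m C nm n k)).length ≤ ℓO := by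
      refine (CoinNormalisation.two_pow_width_le qO _).trans ?_
      have h0 := length_inO_x0_le hK m C nm n k hpκ
      have h1 := SeedLaw.natPoly_eval_mono (L0P pκ) (hkey k hk).1
      have := SeedLaw.natPoly_eval_mono qO (h0.trans h1)
      rw [hℓO]
      exact_mod_cast (by omega : 2 * qO.eval (inO K (x0 m C nm n k)).length + 2 ≤
        2 * qO.eval ((L0P pκ).eval Lmax) + 2)
    calc uniformAvg (O.coins (κ n) (C k)) (fun r => A₁.pr id (x1 O κ m C nm n k r) {y | ans k <+: y})
        = 2 ^ CoinNormalisation.width qO (inO K (x0 m C nm n k)).length *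
            (1 / 2 ^ CoinNormalisation.width qO (inO K (x0 m C nm n k)).length *
              uniformAvg (O.coins (κ n) (C k))
                (fun r => A₁.pr id (x1 O κ m C nm n k r) {y | ans k <+: y})) := by
          field_simp
      _ ≤ 2 ^ CoinNormalisation.width qO (inO K (x0 m C nm n k)).length *
            (redAlg K Ob A₁ qO (QP pκ qO sOb pA)).pr id (x0 m C nm n k) {y | ans k <+: y} :=
          mul_le_mul_of_nonneg_left hge hpos.le
      _ ≤ ℓO * (redAlg K Ob A₁ qO (QP pκ qO sOb pA)).pr id (x0 m C nm n k) {y | ans k <+: y} :=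
          mul_le_mul_of_nonneg_right h2w (RandAlg.pr_nonneg _ _ _ _)
  -- Step 4: the clear side is a function of the key only
  have hstep4 : uniformAvg (h n) (fun k => (redAlg K Ob A₁ qO (QP pκ qO sOb pA)).pr id (x0 m C nm n k)
      {y | ans k <+: y}) =
      uniformAvg n (fun s => (redAlg K Ob A₁ qO (QP pκ qO sOb pA)).pr id
        (boolPair (unaryEncodeNat n) (genClear h m C nm s)) {y | keyed h ans s <+: y}) := by
    rw [← SeedLaw.uniformAvg_take_of_le hh (fun k => (redAlg K Ob A₁ qO (QP pκ qO sOb pA)).pr id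
      (x0 m C nm n k) {y | ans k <+: y})]
    refine uniformAvg_congr fun s hs => ?_
    rw [x0_eq h m C nm hs, keyed_eq h ans hs]
  -- assembly
  have hℓA0 : 0 ≤ ℓA := by rw [hℓA]; positivity
  have hloss : (((lossP pκ qO sOb pA q).eval n : ℕ) : ℝ) = ℓA * ℓO := by
    rw [eval_lossP, hℓA, hℓO, hLmax]
    push_cast
    ring
  calc uniformAvg n (fun s => A.pr id (boolPair (unaryEncodeNat n) (genObf O κ h m C nm s))
        {y | keyed h ans s <+: y})
      ≤ uniformAvg n (fun s => ℓA * A₁.pr id (boolPair (unaryEncodeNat n) (genObf O κ h m C nm s))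
          {y | keyed h ans s <+: y}) := SeedLaw.uniformAvg_mono hstep1
    _ = ℓA * uniformAvg (h n) (fun k => uniformAvg (O.coins (κ n) (C k))
          (fun r => A₁.pr id (x1 O κ m C nm n k r) {y | ans k <+: y})) := by
        rw [SeedLaw.uniformAvg_const_mul, hstep2]
    _ ≤ ℓA * uniformAvg (h n) (fun k => ℓO * (redAlg K Ob A₁ qO (QP pκ qO sOb pA)).pr id (x0 m C nm n k)
          {y | ans k <+: y}) := mul_le_mul_of_nonneg_left (SeedLaw.uniformAvg_mono hstep3) hℓA0
    _ = ℓA * ℓO * uniformAvg n (fun s => (redAlg K Ob A₁ qO (QP pκ qO sOb pA)).pr id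
          (boolPair (unaryEncodeNat n) (genClear h m C nm s)) {y | keyed h ans s <+: y}) := by
        rw [SeedLaw.uniformAvg_const_mul, hstep4, mul_assoc]
    _ = _ := by rw [hloss]

end ObfMono

/-- **STUB 2 of line `knowledge-of-walk-split` — obfuscation is monotone** (ideator-3's lemma (a), re-typed):
clause (C) for the CLEAR key-indexed circuit family `C` (instances `⟨code (C k), nm k⟩`, keyed answer
`ans k`) implies clause (C) for its honest obfuscations `⟨code (O(κ n, C k; U)), nm k⟩`, for every EFFICIENT
obfuscator `O` (no security property is used), unary-poly-time schedule `κ ≤ poly`, key length `h n ≤ n`,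
polynomially long clear instances, and the EVENTUAL coin discipline `O.coins (κ n) (C k) ≤ n − h n`
(`n ≥ n₀`; lead's reshape after Disproof §6 T-b).  Proof: a PPT
`A` against the obfuscated instances yields the PPT reduction `ObfMono.redAlg` against the clear instances —
it recomputes `O`'s input `⟨1^{κ n}, code (C k)⟩`, GUESSES `O`'s (non-computable) coin count, re-obfuscates
with a prefix of its own coins and runs the coin-count normalisation `A₁` of `A` on the manufactured instance
(`ObfMono.isPPT_redAlg`, via total `FP` extensions of the machines of `κ`, `O`, `A₁`); on the correct guess
the manufactured instance has exactly the law of the obfuscated instance (seed law), so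
`succ_A(genObf, n) ≤ lossP(n) · succ_{A'}(genClear, n)` for `n ≥ n₀` (`ObfMono.domination`), and the
right-hand side decays superpolynomially by the hypothesis. [cite: AroraBarakCC2009, §7.1] -/
theorem stub_obfuscationMonotone :
    ∀ (O : CircuitObfuscator), O.IsEfficient →
    ∀ (κ h : ℕ → ℕ) (m : List Bool → ℕ) (C : (k : List Bool) → Circuit (Fin (m k)))
      (nm ans : List Bool → List Bool),
      PolyTimeComputable Computability.unaryEncodeNat Computability.unaryEncodeNat κ →
      (∃ p : Polynomial ℕ, ∀ n, κ n ≤ p.eval n) → (∀ n, h n ≤ n) →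
      (∃ q : Polynomial ℕ, ∀ s : List Bool, (genClear h m C nm s).length ≤ q.eval s.length) →
      (∃ n₀ : ℕ, ∀ s : List Bool, n₀ ≤ s.length →
          O.coins (κ s.length) (C (s.take (h s.length))) ≤ s.length - h s.length) →
      ClauseC (genClear h m C nm) (keyed h ans) →
      ClauseC (genObf O κ h m C nm) (keyed h ans) := by
  intro O hO κ h m C nm ans hκ hκp hh hq hcoins hC A hA
  obtain ⟨pκ, hpκ⟩ := hκp
  obtain ⟨q, hq⟩ := hq
  obtain ⟨pA, hpA⟩ := hA.2
  obtain ⟨qO, hqO⟩ := hO.2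
  obtain ⟨K, hK, hKval⟩ := FPExtension.exists_FP_unary hκ
  obtain ⟨Ob, hOb, hObval⟩ := FPExtension.exists_FP_obf hO
  obtain ⟨sOb, hsOb⟩ := FPExtension.exists_poly_length_le hOb
  obtain ⟨n₀, hcoins⟩ := hcoins
  have hqO' : ∀ L, O.coinLen L ≤ qO.eval L := hqO
  have hA' : IsPPT (ObfMono.redAlg K Ob (CoinNormalisation.norm A pA) qO (ObfMono.QP pκ qO sOb pA)) id :=
    ObfMono.isPPT_redAlg hK hOb (CoinNormalisation.isPPT_norm hA pA) _ _
  have hA₁c : ∀ L, (CoinNormalisation.norm A pA).coinLen L ≤ 2 * pA.eval L + 1 := fun L => by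
    have := CoinNormalisation.width_le pA L
    show CoinNormalisation.width pA L + pA.eval L ≤ _
    omega
  refine ((hC _ hA').polynomial_mul ((ObfMono.lossP pκ qO sOb pA q).map (Nat.castRingHom ℝ)))
    |>.trans_eventually_abs_le ?_
  filter_upwards [Filter.eventually_ge_atTop n₀] with n hn
  simp only [Function.comp_apply, Polynomial.eval_natCast_map, eq_natCast]
  rw [abs_of_nonneg (uniformAvg_nonneg fun s => RandAlg.pr_nonneg _ _ _ _),
    abs_of_nonneg (mul_nonneg (Nat.cast_nonneg _) (uniformAvg_nonneg fun s => RandAlg.pr_nonneg _ _ _ _))]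
  exact ObfMono.domination hKval hObval hsOb hpκ hqO'
    (fun x E N hN => CoinNormalisation.uniformProb_norm_of_le A pA x E hN)
    (fun x E => CoinNormalisation.pr_le_two_pow_mul A pA x E (hpA _)) hA₁c hq (hh n)
    (fun s hs => ObfMono.coins_seed_le hcoins hn hs)

end Summit.QuantumAdvantage.QuantumAdvantage.Theorems.WbwObfuscatedGluedTrees.KnowledgeOfWalk

end
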